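import Summits.BirchSwinnertonDyer.BirchSwinnertonDyer.Theorems.SylvesterTwoHeegnerIndexUnramifiedQuadraticDescent
import Literature.NumberTheory.EllipticCurves.HeegnerPointsKolyvaginPairingCMConj
import HarnessLib

/-!
# Leaf (L3) of the coupled Kolyvagin descent at `2` — algebraic preparation

Helper toward crux `UpperOffV0HSYPlus` (stmt-BirchSwinnertonDyer-19804) of route
`SylvesterTwoHeegnerIndex` (rung K7t, leaf `X12.CMAtTwo`), skeleton VARIANT K, leaf (L3) «Čebotarev
realizability» of `SylvesterTwoCoupledDescent.selmerGroup_eq_bot_and_le_closure_of_coupledLeaves`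
(`Theorems/SylvesterTwoHeegnerIndexCoupledDescentAtTwo.lean`, clauses `hL3a` / `hL3b`; cell memo
MEMO-bsd-cm-two §57.4 Steps 2–5). The (L3) ASSEMBLY (planner bsd-cm-plan D400 (3)) combines
the tree's Literature theorems

* `IsLiftOfAut.exists_h1Eval_conj_mul_eq_of_comm` / `exists_h1Eval_eq_pair_of_comm` — the Galois
  element `ρ` with prescribed values `[x_i, ρ]` on `σ`-FIXED classes of one / two curves
  (`HeegnerPointsKolyvaginPairingCM{,Conj,Pair}`), and
* `exists_kolyvaginPrime_gt_of_galoisElement_pair` — the Čebotarev step turning `ρ` into inert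
  Kolyvagin primes with McCallum's local criterion on both curves
  (`HeegnerPointsKolyvaginCebotarevPairProofs`),

and needs three pieces of bookkeeping, proved here once, abstractly, with no arithmetic input:

* §A `exists_indep_subfamily`, `exists_indep_subfamily_mem` — in an additive group killed by a
  prime `p`, finitely many elements `u_j` admit a sub-family `x_i` (some of the `u_j`) which is
  `𝔽_p`-INDEPENDENT (no relation `∑ a_i x_i = 0` except `p ∣ a_i`) and whose `ℤ`-span contains
  every `u_j`, optionally containing a prescribed non-zero `u_{j₀}` (Mathlib's
  `exists_linearIndepOn_extension` over `ZMod p`, restated without instances);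
* §B from LEMMA D (`SylvesterTwoUnramifiedDescent.descent_injective/surjective`: for `w` with
  `w² + w + 1 = 0` and an involution `σ` with `σ w = w̄ σ` on a group where `3` is bijective, the map
  `(s, t) ↦ s + w t` on `σ`-fixed pairs is bijective): `three_zsmul_bijective_of_prime_torsion`
  (`3` is bijective on a group killed by a prime `p ≠ 3`), `exists_fixed_add_apply_fixed`
  (every class is `s₀ + w s₁` with `σ`-fixed `s₀, s₁` — memo Step 3's `H = H^σ ⊗ 𝔽₄`), and
  `dvd_and_dvd_of_sum_fixed_eq_zero` (an `𝔽_p`-independent family of `σ`-fixed classes is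
  `(ℤ/p)[w]`-independent — the hypothesis `hind` of the `…PairingCM` theorems);
* §C `h1Eval_conj_mul_eq_of_h1Eval_eq` — the `(1 + τ)`-bookkeeping of
  `IsLiftOfAut.exists_h1Eval_conj_mul_eq_of_comm` for a GIVEN `ρ` (values `[x_i, ρ] = v_i` ⇒
  `[x_i, (τ⁻¹ρmτ)(ρm)] = τ v_i + v_i` and `[wH x_i, ·] = w (τ v_i + v_i)` for `m ∈ 𝒩`), so that
  the JOINT `ρ` of the two-curve theorem can be fed to it curve by curve.

Everything is generic (any prime `p`, any group / any Weierstrass curve and field tower); nothing is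
asserted about 19804; no definition, no named fact, no instance, no `sorry`. BSD is not claimed.
-/

-- every Summits module is named `Summit.<Summit>.<Problem>…`: the duplicated component is by design
set_option linter.dupNamespace false

noncomputable section

open scoped Classical
open WeierstrassCurve

universe u v

namespace Summit.BirchSwinnertonDyer.BirchSwinnertonDyer.Theorems.SylvesterTwoCoupledDescentCebotarev

/-! ## §A  `𝔽_p`-independent sub-families spanning finitely many classes -/

section SubFamily

variable {M : Type*} [AddCommGroup M]

/-- Core of §A over an arbitrary `ZMod p`-module structure (they all have `(a : ZMod p) • x = a • x`
for `a : ℤ`): extend an independent set of indices `S` to `b ⊆ Fin k` with `u '' univ ⊆ span (u '' b)`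
(`exists_linearIndepOn_extension`), enumerate `b` by `Fin r`, and restate independence and
membership with integer coefficients. -/
private theorem exists_indep_subfamily_core {p : ℕ} [Fact p.Prime] [Module (ZMod p) M] {k : ℕ}
    (u : Fin k → M) (S : Set (Fin k)) (hS : LinearIndepOn (ZMod p) u S) :
    ∃ (r : ℕ) (xs : Fin r → M), (∀ j ∈ S, ∃ i, xs i = u j) ∧ (∀ i, ∃ j, xs i = u j) ∧
      (∀ a : Fin r → ℤ, ∑ i, a i • xs i = 0 → ∀ i, (p : ℤ) ∣ a i) ∧
      (∀ j, ∃ c : Fin r → ℤ, u j = ∑ i, c i • xs i) := by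
  obtain ⟨b, -, hSb, hspan, hind⟩ := exists_linearIndepOn_extension hS (Set.subset_univ S)
  haveI : Fintype b := Fintype.ofFinite b
  set e := Fintype.equivFin b with he
  refine ⟨Fintype.card b, fun i ↦ u (e.symm i), fun j hj ↦ ⟨e ⟨j, hSb hj⟩, by simp⟩,
    fun i ↦ ⟨e.symm i, rfl⟩, fun a ha i ↦ ?_, fun j ↦ ?_⟩
  · have hli : LinearIndependent (ZMod p) (fun i : Fin (Fintype.card b) ↦ u (e.symm i)) :=
      (linearIndependent_equiv e.symm).mpr hind
    have h0 : ∑ i, ((a i : ZMod p)) • u (e.symm i) = 0 := by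
      simpa only [Int.cast_smul_eq_zsmul] using ha
    exact (ZMod.intCast_zmod_eq_zero_iff_dvd (a i) p).mp
      (Fintype.linearIndependent_iff.mp hli (fun i ↦ (a i : ZMod p)) h0 i)
  · have hrange : Set.range (fun i : Fin (Fintype.card b) ↦ u (e.symm i)) = u '' b := by
      ext x
      constructor
      · rintro ⟨i, rfl⟩
        exact ⟨e.symm i, (e.symm i).2, rfl⟩
      · rintro ⟨j', hj', rfl⟩
        exact ⟨e ⟨j', hj'⟩, by simp⟩
    have hj : u j ∈ Submodule.span (ZMod p)
        (Set.range fun i : Fin (Fintype.card b) ↦ u (e.symm i)) := by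
      rw [hrange]
      exact hspan ⟨j, Set.mem_univ _, rfl⟩
    obtain ⟨c, hc⟩ := Submodule.mem_span_range_iff_exists_fun (ZMod p) |>.mp hj
    refine ⟨fun i ↦ ((c i).val : ℤ), ?_⟩
    rw [← hc]
    refine Finset.sum_congr rfl fun i _ ↦ ?_
    rw [← Int.cast_smul_eq_zsmul (ZMod p), Int.cast_natCast, ZMod.natCast_zmod_val]

/-- **An `𝔽_p`-independent sub-family spanning finitely many classes.** In an additive group
killed by a prime `p`, for `u_1, …, u_k` there are `x_1, …, x_r` among the `u_j` with no relation
`∑ a_i x_i = 0` (`a_i ∈ ℤ`) other than `p ∣ a_i` for all `i`, and integers with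
`u_j = ∑ c_{ji} x_i` for every `j` (a basis of the `𝔽_p`-span, Mathlib
`exists_linearIndepOn_extension` for the `ZMod p`-module structure `AddCommGroup.zmodModule`).
[folklore] -/
theorem exists_indep_subfamily {p : ℕ} (hp : p.Prime) (hM : ∀ x : M, (p : ℤ) • x = 0) {k : ℕ}
    (u : Fin k → M) :
    ∃ (r : ℕ) (xs : Fin r → M), (∀ i, ∃ j, xs i = u j) ∧
      (∀ a : Fin r → ℤ, ∑ i, a i • xs i = 0 → ∀ i, (p : ℤ) ∣ a i) ∧
      (∀ j, ∃ c : Fin r → ℤ, u j = ∑ i, c i • xs i) := by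
  haveI : Fact p.Prime := ⟨hp⟩
  letI : Module (ZMod p) M :=
    AddCommGroup.zmodModule (n := p) fun x ↦ by rw [← natCast_zsmul]; exact hM x
  obtain ⟨r, xs, -, h1, h2, h3⟩ := exists_indep_subfamily_core u ∅ (linearIndepOn_empty (ZMod p) u)
  exact ⟨r, xs, h1, h2, h3⟩

/-- **The same, containing a prescribed non-zero `u_{j₀}`** (extend the independent singleton
`{j₀}`). [folklore] -/
theorem exists_indep_subfamily_mem {p : ℕ} (hp : p.Prime) (hM : ∀ x : M, (p : ℤ) • x = 0)
    {k : ℕ} (u : Fin k → M) (j₀ : Fin k) (hj₀ : u j₀ ≠ 0) :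
    ∃ (r : ℕ) (xs : Fin r → M), (∃ i₀, xs i₀ = u j₀) ∧ (∀ i, ∃ j, xs i = u j) ∧
      (∀ a : Fin r → ℤ, ∑ i, a i • xs i = 0 → ∀ i, (p : ℤ) ∣ a i) ∧
      (∀ j, ∃ c : Fin r → ℤ, u j = ∑ i, c i • xs i) := by
  haveI : Fact p.Prime := ⟨hp⟩
  letI : Module (ZMod p) M :=
    AddCommGroup.zmodModule (n := p) fun x ↦ by rw [← natCast_zsmul]; exact hM x
  -- `{j₀}` is independent: `g • u j₀ = 0` with `g ≠ 0` in the field `ZMod p` forces `u j₀ = 0`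
  have hS : LinearIndepOn (ZMod p) u {j₀} := by
    rw [LinearIndepOn, linearIndependent_iff']
    intro s g hg i hi
    by_contra hgi
    apply hj₀
    have hij : (i : Fin k) = j₀ := i.2
    have hsum : ∑ x ∈ s, g x • u (x : Fin k) = g i • u j₀ := by
      rw [Finset.sum_eq_single i, hij]
      · intro b _ hbi
        exact absurd (Subsingleton.elim b i) hbi
      · intro hi'
        exact absurd hi hi'
    rw [hsum] at hg
    calc u j₀ = (g i)⁻¹ • (g i • u j₀) := by rw [smul_smul, inv_mul_cancel₀ hgi, one_smul]
      _ = 0 := by rw [hg, smul_zero]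
  obtain ⟨r, xs, h0, h1, h2, h3⟩ := exists_indep_subfamily_core u {j₀} hS
  exact ⟨r, xs, h0 j₀ rfl, h1, h2, h3⟩

end SubFamily

/-! ## §B  Consequences of LEMMA D: `σ`-fixed decomposition and `(ℤ/p)[w]`-independence -/

section Descent

variable {M : Type*} [AddCommGroup M]

/-- `3` acts bijectively on an additive group killed by a prime `p ≠ 3` (Bézout: `3u + pv = 1`).
[folklore] -/
theorem three_zsmul_bijective_of_prime_torsion {p : ℕ} (hp : p.Prime) (hp3 : p ≠ 3)
    (hM : ∀ x : M, (p : ℤ) • x = 0) : Function.Bijective fun x : M => (3 : ℤ) • x := by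
  have hcop : Nat.Coprime 3 p := (Nat.coprime_primes Nat.prime_three hp).mpr (Ne.symm hp3)
  have hbez : (3 : ℤ) * Nat.gcdA 3 p + (p : ℤ) * Nat.gcdB 3 p = 1 := by
    have h := Nat.gcd_eq_gcd_ab 3 p
    rw [hcop.gcd_eq_one] at h
    push_cast at h
    exact h.symm
  set t := Nat.gcdA 3 p with ht
  have h3t : ∀ x : M, (3 * t) • x = x := fun x ↦ by
    have h1 : (3 : ℤ) * t = 1 - (p : ℤ) * Nat.gcdB 3 p := by rw [← hbez]; ring
    rw [h1, sub_smul, one_smul, mul_comm, ← smul_smul, hM, smul_zero, sub_zero]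
  refine Function.bijective_iff_has_inverse.mpr ⟨fun x ↦ t • x, fun x ↦ ?_, fun x ↦ ?_⟩
  · show t • ((3 : ℤ) • x) = x
    rw [smul_smul, mul_comm, h3t]
  · show (3 : ℤ) • (t • x) = x
    rw [smul_smul, h3t]

/-- **`σ`-fixed decomposition (memo two §57.4 Step 3: `H = H^σ ⊗ 𝔽₄`).** For `w` with
`w² + w + 1 = 0`, an additive involution `σ` with `σ (w x) = −σ x − w (σ x)`, on a group where `3` is
bijective: every `m` is `s + w t` with `σ s = s`, `σ t = t`
(`SylvesterTwoUnramifiedDescent.descent_surjective`). [folklore] -/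
theorem exists_fixed_add_apply_fixed (w σ : M →+ M) (hw : ∀ x, w (w x) + w x + x = 0)
    (hσ : ∀ x, σ (σ x) = x) (hσw : ∀ x, σ (w x) = -(σ x) - w (σ x))
    (h3 : Function.Bijective fun x : M => (3 : ℤ) • x) (m : M) :
    ∃ s t : M, σ s = s ∧ σ t = t ∧ m = s + w t := by
  obtain ⟨⟨s, t⟩, hst⟩ := SylvesterTwoUnramifiedDescent.descent_surjective w σ hw hσ hσw h3 m
  exact ⟨s, t, (SylvesterTwoUnramifiedDescent.mem_ker_sub_id_iff σ _).mp s.2,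
    (SylvesterTwoUnramifiedDescent.mem_ker_sub_id_iff σ _).mp t.2, by simpa using hst.symm⟩

/-- **`(ℤ/p)[w]`-independence of an independent `σ`-fixed family (memo two §57.4 Step 3; the
hypothesis `hind` of `exists_h1Eval_eq_of_comm`).** With `w`, `σ`, `3` as in
`exists_fixed_add_apply_fixed`: if `σ x_i = x_i` and the `x_i` have no relation `∑ a_i x_i = 0`
except `p ∣ a_i`, then `∑ (a_i x_i + b_i w x_i) = 0` forces `p ∣ a_i` and `p ∣ b_i`
(`descent_injective`: `s + w t = 0` with `s = ∑ a_i x_i`, `t = ∑ b_i x_i` fixed gives `s = t = 0`).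
[folklore] -/
theorem dvd_and_dvd_of_sum_fixed_eq_zero (w σ : M →+ M) (hw : ∀ x, w (w x) + w x + x = 0)
    (hσw : ∀ x, σ (w x) = -(σ x) - w (σ x))
    (h3 : Function.Bijective fun x : M => (3 : ℤ) • x) {r : ℕ} {xs : Fin r → M}
    (hfix : ∀ i, σ (xs i) = xs i) {p : ℤ}
    (hind : ∀ a : Fin r → ℤ, ∑ i, a i • xs i = 0 → ∀ i, p ∣ a i) (a b : Fin r → ℤ)
    (hab : ∑ i, (a i • xs i + b i • w (xs i)) = 0) (i : Fin r) : p ∣ a i ∧ p ∣ b i := by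
  have hS : ∀ c : Fin r → ℤ, σ (∑ i, c i • xs i) = ∑ i, c i • xs i := fun c ↦ by
    rw [map_sum]
    exact Finset.sum_congr rfl fun i _ ↦ by rw [map_zsmul, hfix]
  have hmem : ∀ c : Fin r → ℤ, (∑ i, c i • xs i) ∈ (σ - AddMonoidHom.id M).ker := fun c ↦
    (SylvesterTwoUnramifiedDescent.mem_ker_sub_id_iff σ _).mpr (hS c)
  have hsum : (∑ i, a i • xs i) + w (∑ i, b i • xs i) = 0 := by
    rw [map_sum, ← Finset.sum_add_distrib, ← hab]
    exact Finset.sum_congr rfl fun i _ ↦ by rw [map_zsmul]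
  have hinj := SylvesterTwoUnramifiedDescent.descent_injective w σ hw hσw h3
    (a₁ := (⟨_, hmem a⟩, ⟨_, hmem b⟩))
    (a₂ := (⟨0, AddSubgroup.zero_mem _⟩, ⟨0, AddSubgroup.zero_mem _⟩))
    (by simpa using hsum)
  have ha : ∑ i, a i • xs i = 0 :=
    congrArg (fun st : (σ - AddMonoidHom.id M).ker × (σ - AddMonoidHom.id M).ker ↦ (st.1 : M)) hinj
  have hb : ∑ i, b i • xs i = 0 :=
    congrArg (fun st : (σ - AddMonoidHom.id M).ker × (σ - AddMonoidHom.id M).ker ↦ (st.2 : M)) hinj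
  exact ⟨hind a ha i, hind b hb i⟩

/-- **Coefficient test for non-vanishing.** If `∑ (a_i x_i + b_i w x_i) = s ≠ 0` then some index has
`¬ (p ∣ a_i ∧ p ∣ b_i)` — for a group killed by `p` (the divisible coefficients contribute `0`).
[folklore] -/
theorem exists_not_dvd_of_sum_ne_zero (w : M →+ M) {p : ℤ} (hM : ∀ x : M, p • x = 0) {r : ℕ}
    (xs : Fin r → M) (a b : Fin r → ℤ) (hs : ∑ i, (a i • xs i + b i • w (xs i)) ≠ 0) :
    ∃ i, ¬ (p ∣ a i ∧ p ∣ b i) := by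
  by_contra h
  push Not at h
  apply hs
  refine Finset.sum_eq_zero fun i _ ↦ ?_
  obtain ⟨⟨ka, hka⟩, ⟨kb, hkb⟩⟩ := h i
  rw [hka, hkb, mul_comm p ka, mul_comm p kb, ← smul_smul, ← smul_smul, hM, hM, smul_zero,
    smul_zero, add_zero]

end Descent

/-! ## §C  The `(1 + τ)`-bookkeeping for a given `ρ` -/

section Bookkeeping

open Literature.NumberTheory.EllipticCurves Literature.NumberTheory.GaloisRepresentations

variable {k : Type v} {K : Type u} [Field k] [Field K] [Algebra k K] (W : WeierstrassCurve k)
variable {σ : K ≃ₐ[k] K} {τ : AlgebraicClosure K ≃+* AlgebraicClosure K}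

/-- **`(1 + τ)`-bookkeeping for a GIVEN Galois element** (the computation inside the tree's
`IsLiftOfAut.exists_h1Eval_conj_mul_eq_of_comm`, `HeegnerPointsKolyvaginPairingCMConj`, with the
choice of `ρ` removed): for an involutive lift `τ` of `σ`, an additive `w` on `E[p]` with `w³ = 1`,
an operator `wH` on `H¹(K, E[p])` over `w` (`hwH`) with the semilinearity relations
`σ_* (wH x) = wH (wH (σ_* x))`, `τ (w P) = w (w (τ P))`, `σ`-FIXED classes `x_i`, and ANY
`ρ ∈ Γ_{K(E[p])}` with values `[x_i, ρ] = v_i`: for every `m ∈ 𝒩(x)` and `F = (τ⁻¹(ρm)τ)(ρm)`,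
`[x_i, F] = τ v_i + v_i` and `[wH x_i, F] = w (τ v_i + v_i)`.
[cite: McCallumLMS1991, Prop. 3.1 (proof)] -/
theorem h1Eval_conj_mul_eq_of_h1Eval_eq (hτ : IsLiftOfAut σ τ)
    (hinv : ∀ x, τ (τ x) = x) {p : ℕ}
    (w : geomTorsion (W.baseChange K) p →+ geomTorsion (W.baseChange K) p)
    (hw3 : ∀ P, w (w (w P)) = P)
    (wH : galH1Torsion (W.baseChange K) p →+ galH1Torsion (W.baseChange K) p)
    (hwH : ∀ x, ∀ ρ ∈ torsionFixing (W.baseChange K) p,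
      h1Eval (W.baseChange K) p (wH x) ρ = w (h1Eval (W.baseChange K) p x ρ))
    (hσw : ∀ x, conjAct W σ p (wH x) = wH (wH (conjAct W σ p x)))
    (hτw : ∀ P, hτ.torsionMap W p (w P) = w (w (hτ.torsionMap W p P)))
    {r : ℕ} {xs : Fin r → galH1Torsion (W.baseChange K) p}
    (hxs : ∀ i, conjAct W σ p (xs i) = xs i) {ρ : Field.absoluteGaloisGroup K}
    (hρ : ρ ∈ torsionFixing (W.baseChange K) p) (v : Fin r → geomTorsion (W.baseChange K) p)
    (hρv : ∀ i, h1Eval (W.baseChange K) p (xs i) ρ = v i) {m : Field.absoluteGaloisGroup K}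
    (hm : m ∈ evalKer (W.baseChange K) p xs) (i : Fin r) :
    h1Eval (W.baseChange K) p (xs i) (hτ.conjGalCMH (ρ * m) * (ρ * m)) =
        hτ.torsionMap W p (v i) + v i ∧
      h1Eval (W.baseChange K) p (wH (xs i)) (hτ.conjGalCMH (ρ * m) * (ρ * m)) =
        w (hτ.torsionMap W p (v i) + v i) := by
  have hρm : ρ * m ∈ torsionFixing (W.baseChange K) p := mul_mem hρ hm.1
  have hρm' := hτ.conjGalCMH_mem_torsionFixing W hinv _ hρm
  have hx : h1Eval (W.baseChange K) p (xs i) (ρ * m) = v i := by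
    rw [h1Eval_mul _ _ _ hρ, hρv i, hm.2 i, add_zero]
  have hτww : ∀ Q, hτ.torsionMap W p (w (w Q)) = w (hτ.torsionMap W p Q) := fun Q ↦ by
    rw [hτw, hτw, hw3]
  constructor
  · rw [h1Eval_mul _ _ _ hρm', hτ.h1Eval_conjGalCMH W hinv _ _ hρm, hxs i, hx]
  · rw [h1Eval_mul _ _ _ hρm', hτ.h1Eval_conjGalCMH W hinv _ _ hρm, hσw, hxs i, hwH _ _ hρm,
      hwH _ _ hρm, hx, hτww, map_add]

/-- **The value on a class of the `(ℤ/p)[w]`-span, coefficientwise** (as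
`h1Eval_conj_mul_sum_eq_of_comm`, for general values): with `[x_i, F] = t_i` and
`[wH x_i, F] = w t_i`, `[∑ (a_i x_i + b_i wH x_i), F] = ∑ (a_i t_i + b_i w t_i)`. [folklore] -/
theorem h1Eval_sum_eq_sum {p : ℕ}
    (w : geomTorsion (W.baseChange K) p →+ geomTorsion (W.baseChange K) p)
    (wH : galH1Torsion (W.baseChange K) p →+ galH1Torsion (W.baseChange K) p)
    {r : ℕ} {xs : Fin r → galH1Torsion (W.baseChange K) p}
    (t : Fin r → geomTorsion (W.baseChange K) p) {F : Field.absoluteGaloisGroup K}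
    (hF : F ∈ torsionFixing (W.baseChange K) p)
    (hxF : ∀ i, h1Eval (W.baseChange K) p (xs i) F = t i)
    (hwF : ∀ i, h1Eval (W.baseChange K) p (wH (xs i)) F = w (t i)) (a b : Fin r → ℤ) :
    h1Eval (W.baseChange K) p (∑ i, (a i • xs i + b i • wH (xs i))) F =
      ∑ i, (a i • t i + b i • w (t i)) := by
  rw [h1Eval_sum _ _ _ _ hF]
  simp only [h1Eval_add _ _ _ _ hF, h1Eval_zsmul _ _ _ _ hF, hxF, hwF]

end Bookkeeping

end Summit.BirchSwinnertonDyer.BirchSwinnertonDyer.Theorems.SylvesterTwoCoupledDescentCebotarev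

end
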